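import Summits.BirchSwinnertonDyer.BirchSwinnertonDyer.Theorems.SylvesterTwoHeegnerIndexUpperOffV0ReductionDatumSupersingular
import Literature.NumberTheory.EllipticCurves.HuShuYin2019.SylvesterNineMinimalModel
import HarnessLib

/-!
# (F) of leaf (L1), crux `UpperOffV0HSYPlus` (stmt-BirchSwinnertonDyer-19804): the REDUCTION DATUM of the
# CM frame `E₉ = (cubeSumCurve 9)_K` at a Kolyvagin prime `ℓ ≡ 2 (3)` of the pair at `2`, in the binder
# shape of k-ty1 #14 (`JZero.zsmul_kolyvaginClass_cubicTwist_mem_selmerLocalKer_iff_mem_torsionLocalKer`)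

Skeleton of record VARIANT M (`Cruxes/UpperOffV0HSYPlus/Lines/coupled_variantM.lean` 406ca288e244d392);
card v28.  The AT-LEVEL FLIP one-call (#14, p650073) displays a reduction datum on the frame curve
`W = (cubeSumCurve 9)_K`: `red : W(K̄) →+ Ẽ₀(𝔽̄_ℓ)`, the `ℓ`-Frobenius `φ`, the reduced CM maps `ρ̃_g`
with `red ∘ ρ_g = ρ̃_g ∘ red` and `ρ̃_g ∘ φ = φ ∘ ρ̃_g²`, `red` invariant under `I_𝔓`,
`red ∘ F = φ² ∘ red`, `red` injective on `W[2]`, `φ² = 1` on `Ẽ₀[2]`, and the supersingular core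
`hχ` (`l' φ c = 0 ⟺ c ∈ 2·{φ² = 1}`, `ℓ + 1 = 2 l'`).  THIS FILE produces all of it, ONE CALL, from
the tree: k7t-c2 g6's `exists_reductionDatum_of_frobeniusTrace_eq_zero` on the minimal model
`W₀ = (y² + y = x³ − 1)` of `E₉` (k-ty1 #16: globally minimal, `Δ_min = −243`, `a_ℓ = 0` at
`ℓ ≡ 2 (3)`) — called at torsion level `n = 1`, so that its torsion-fixing hypothesis on `F` is void
(`F` need not fix `E₉[2] ∌ ` the frame; `∛6 ∉ H_{9pn}`) — transported to the frame by k-ty1 #15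
`JZero.exists_reduced_mulX_frame` along the equivariant frame transport `κ` (#16), with the two
level-`2` conjuncts re-derived: injectivity on `W[2]` from `eq_zero_of_smul_eq_zero_of_geomReduction_eq_zero`
(`ℓ ∤ 2`) and `φ² = 1` on `Ẽ₀[2]` from Manin's relation `φ² = −ℓ` (`a_ℓ = 0`, `ℓ` odd).

* `exists_frame_reductionDatum` — the datum for the `ρ`-family of ANY cube root `v` (`(g v)³ = v³`,
  `ρ_g (x, y) = ((g v / v)² x, y)`): used with `v = v_A` and `ρ_A = ρ ∘ ρ` (block 1 of (L1)) and with
  `v = v_B`, `ρ` (block 2).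

HONEST FRAMING: theorems only (no definition, no named fact, no instance, no notation); assembly of PROVED
tree theorems; nothing about Sel/Ш/BSD; no stub closed; `--supports stmt-BirchSwinnertonDyer-19804 --as helper`.

## References
* W. G. McCallum, LMS LNS 153 (1991), Prop. 4.4 (proof). [McCallumLMS1991]
* B. H. Gross, LMS LNS 153 (1991), §3 (3.2)–(3.4), Prop. 6.2 (2). [GrossLMS1991]
* J. H. Silverman, *AEC*, V.2.3.1 (Manin/Hasse relation), VII.3.1(b). [SilvermanAEC2009]
* Y. Hu, J. Shu, H. Yin, Trans. AMS 372 (2019), arXiv 1708.05266, §1 p. 4, §2. [HuShuYin2019]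

## Mathlib / tree search
Tree: `SylvesterTwoUpper.exists_reductionDatum_of_frobeniusTrace_eq_zero` (k7t-c2 g6),
`JZero.exists_reduced_mulX_frame` (k-ty1 #15), `HuShuYin2019.frobeniusTrace_sylvesterNineMinimal_eq_zero`,
`not_dvd_minimalDiscriminantInt_sylvesterNineMinimal`, `isGloballyMinimal_sylvesterNineMinimal` (#16),
`frobenius_frobenius_sub_trace_smul_add_card_smul`, `frobeniusTrace_eq_sub_natCard_reductionModPrime`,
`eq_zero_of_smul_eq_zero_of_geomReduction_eq_zero`. `lean search 'frame_reductionDatum'` → nothing before this file.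
presearch: n/a (assembly of tree theorems).
-/

set_option linter.dupNamespace false -- Summits modules are `Summit.<Summit>.<Problem>…` by design
set_option autoImplicit false

noncomputable section

open scoped Classical Pointwise

namespace Summit.BirchSwinnertonDyer.BirchSwinnertonDyer.Theorems.SylvesterTwoCMFlip

open WeierstrassCurve Field NumberField IsDedekindDomain
open Literature.NumberTheory.EllipticCurves Literature.NumberTheory.GaloisRepresentations
  Literature.NumberTheory.EllipticCurves.HuShuYin2019
  Summit.BirchSwinnertonDyer.BirchSwinnertonDyer.Theorems.SylvesterTwoUpper

universe u

variable {K : Type u} [Field K] [NumberField K]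

/-- **The reduction datum of the CM frame `E₉ = (cubeSumCurve 9)_K` at a Kolyvagin prime `ℓ ≡ 2 (3)`,
`ℓ ≠ 2`, in k-ty1 #14's binder shape.**  Data: the minimal model `W₀ = (y² + y = x³ − 1)` with
`hΔ : ℓ ∤ Δ_min(W₀)`; an equivariant frame transport `κ : E₉(K̄) ≃+ W₀(K̄)` diagonal on `x`; a cube root
`v ≠ 0` with `(g v)³ = v³` for all `g ∈ Γ_K` and its CM family `ρ_g (x, y) = ((g v / v)² x, y)`; the unique
place `λ = v₀ ∋ ℓ` of `K` with `q_λ = ℓ²`, a prime `𝔓 ∣ λ` of `\bar ℤ_K`, an arithmetic Frobenius `F` at `𝔓`,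
the `ℓ`-Frobenius `φ₀` of `𝔽̄_ℓ`, and `ℓ + 1 = 2 l'`.  Conclusion: `g₀ ∈ Γ_K`, the reduction
`red = geomReduction ∘ θ⁻¹ ∘ g₀⁻¹ ∘ κ : E₉(K̄) →+ Ẽ₀(𝔽̄_ℓ)`, `φ = φ₀` and reduced CM maps `ρ̃_g` with:
`red ∘ ρ_g = ρ̃_g ∘ red`, `ρ̃_g ∘ φ = φ ∘ ρ̃_g²` (the FLIP of the CM action under Frobenius), `red`
`I_𝔓`-invariant, `red ∘ F = φ² ∘ red`, `red` injective on `E₉[2]`, `φ² = 1` on `Ẽ₀[2]` (Manin: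
`φ² = −ℓ`, `ℓ` odd), and the supersingular core `l' φ c = 0 ⟺ ∃ d, φ² d = d ∧ 2 d = c` on `{φ² = 1}`.
[cite: McCallumLMS1991, Prop. 4.4 (proof)] [cite: GrossLMS1991, Prop. 6.2 (2), §3 (3.3)]
[cite: SilvermanAEC2009, Thm. V.2.3.1, Prop. VII.3.1(b)] [cite: HuShuYin2019, §1 p. 4] -/
theorem exists_frame_reductionDatum [(⟨0, 0, 1, 0, -1⟩ : WeierstrassCurve ℚ).IsElliptic]
    [(⟨0, 0, 1, 0, -1⟩ : WeierstrassCurve ℚ).IsGloballyMinimal]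
    {ℓ : ℕ} [Fact ℓ.Prime] (hℓ3 : ℓ % 3 = 2) (hℓ2 : ℓ ≠ 2)
    (hΔ : ¬ (ℓ : ℤ) ∣ minimalDiscriminantInt (⟨0, 0, 1, 0, -1⟩ : WeierstrassCurve ℚ))
    {l' : ℤ} (hl' : ((ℓ + 1 : ℕ) : ℤ) = (2 : ℤ) ^ 1 * l')
    -- the frame transport `E₉(K̄) ≃+ W₀(K̄)`
    (κ : geomPoints ((cubeSumCurve 9).baseChange K) ≃+
      geomPoints ((⟨0, 0, 1, 0, -1⟩ : WeierstrassCurve ℚ).baseChange K))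
    (hκG : ∀ (g : absoluteGaloisGroup K) (P : geomPoints ((cubeSumCurve 9).baseChange K)),
      κ (g • P) = g • κ P)
    {a b d : AlgebraicClosure K}
    (hκ : ∀ {x y : AlgebraicClosure K}
      (h : (((cubeSumCurve 9).baseChange K).baseChange (AlgebraicClosure K)).toAffine.Nonsingular x y),
      ∃ h', κ (.some x y h) = .some (a * x) (b * y + d) h')
    -- the CM family of a cube root `v`
    {v : AlgebraicClosure K} (hv : v ≠ 0)
    (hv3 : ∀ g : absoluteGaloisGroup K,
      ((show AlgebraicClosure K ≃ₐ[K] AlgebraicClosure K from g) v) ^ 3 = v ^ 3)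
    (ρ : absoluteGaloisGroup K →
      geomPoints ((cubeSumCurve 9).baseChange K) ≃+ geomPoints ((cubeSumCurve 9).baseChange K))
    (hρ : ∀ (g : absoluteGaloisGroup K) {x y : AlgebraicClosure K}
      (h : (((cubeSumCurve 9).baseChange K).baseChange (AlgebraicClosure K)).toAffine.Nonsingular x y),
      ∃ h', ρ g (Affine.Point.some x y h) =
        Affine.Point.some (((show AlgebraicClosure K ≃ₐ[K] AlgebraicClosure K from g) v / v) ^ 2 * x) y h')
    -- the place `λ ∋ ℓ`, the prime `𝔓 ∣ λ`, the Frobenii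
    {v₀ : HeightOneSpectrum (𝓞 K)} (hv₀ : (ℓ : 𝓞 K) ∈ v₀.asIdeal)
    (huniq : ∀ w : HeightOneSpectrum (𝓞 K), (ℓ : 𝓞 K) ∈ w.asIdeal → w = v₀)
    (hres : v₀.residueCard = ℓ ^ 2)
    {𝔓 : Ideal (absIntegers (𝓞 K) K)} (h𝔓 : 𝔓 ∈ v₀.primesAbove)
    {F : absoluteGaloisGroup K} (hF : IsArithFrobAt (𝓞 K) F 𝔓)
    {φ₀ : absoluteGaloisGroup (ZMod ℓ)} (hφ₀ : ∀ x : AlgebraicClosure (ZMod ℓ), φ₀ • x = x ^ ℓ) :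
    ∃ (g₀ : absoluteGaloisGroup K)
      (red : geomPoints ((cubeSumCurve 9).baseChange K) →+
        (reductionModPrime (⟨0, 0, 1, 0, -1⟩ : WeierstrassCurve ℚ) ℓ).geomPoints)
      (φ : (reductionModPrime (⟨0, 0, 1, 0, -1⟩ : WeierstrassCurve ℚ) ℓ).geomPoints →+
        (reductionModPrime (⟨0, 0, 1, 0, -1⟩ : WeierstrassCurve ℚ) ℓ).geomPoints)
      (ρt : absoluteGaloisGroup K →
        (reductionModPrime (⟨0, 0, 1, 0, -1⟩ : WeierstrassCurve ℚ) ℓ).geomPoints →+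
          (reductionModPrime (⟨0, 0, 1, 0, -1⟩ : WeierstrassCurve ℚ) ℓ).geomPoints),
      (∀ x, red x = geomReduction hΔ
          ((RatClosure.pointsEquiv (K := K) (⟨0, 0, 1, 0, -1⟩ : WeierstrassCurve ℚ)).symm (g₀⁻¹ • κ x))) ∧
      (∀ b, φ b = φ₀ • b) ∧
      (∀ (g : absoluteGaloisGroup K) (x : geomPoints ((cubeSumCurve 9).baseChange K)),
        red (ρ g x) = ρt g (red x)) ∧
      (∀ (g : absoluteGaloisGroup K) b, ρt g (φ b) = φ (ρt g (ρt g b))) ∧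
      (∀ τ ∈ 𝔓.inertia (absoluteGaloisGroup K), ∀ x, red (τ • x) = red x) ∧
      (∀ x, red (F • x) = φ (φ (red x))) ∧
      (∀ x, ((2 ^ 1 : ℕ) : ℤ) • x = 0 → red x = 0 → x = 0) ∧
      (∀ b, ((2 ^ 1 : ℕ) : ℤ) • b = 0 → φ (φ b) = b) ∧
      (∀ c, φ (φ c) = c → (l' • φ c = 0 ↔ ∃ d, φ (φ d) = d ∧ (((2 : ℕ) : ℤ) ^ 1) • d = c)) := by
  have hℓ : ℓ.Prime := Fact.out
  haveI : (reductionModPrime (⟨0, 0, 1, 0, -1⟩ : WeierstrassCurve ℚ) ℓ).IsElliptic :=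
    isElliptic_reductionModPrime _ hΔ
  set θ := RatClosure.pointsEquiv (K := K) (⟨0, 0, 1, 0, -1⟩ : WeierstrassCurve ℚ) with hθ
  -- `a_ℓ(W₀) = 0`
  have ha0 : (⟨0, 0, 1, 0, -1⟩ : WeierstrassCurve ℚ).frobeniusTrace ℓ = 0 :=
    frobeniusTrace_sylvesterNineMinimal_eq_zero hℓ hℓ3 hℓ2
  -- `F` fixes the `1`-torsion (void)
  have hFfix : F ∈ torsionFixing ((⟨0, 0, 1, 0, -1⟩ : WeierstrassCurve ℚ).baseChange K) ((1 : ℕ) : ℤ) := by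
    rw [mem_torsionFixing_iff]
    intro Q
    have hQ0 : (Q : geomPoints ((⟨0, 0, 1, 0, -1⟩ : WeierstrassCurve ℚ).baseChange K)) = 0 := by
      have h := (mem_geomTorsion_iff _ _ _).mp Q.2
      simpa only [Nat.cast_one, one_zsmul] using h
    apply Subtype.ext
    change F • (Q : geomPoints ((⟨0, 0, 1, 0, -1⟩ : WeierstrassCurve ℚ).baseChange K)) = Q
    rw [hQ0, smul_zero]
  -- g6's reduction datum on the minimal model, at torsion level `1`
  obtain ⟨g₀, red₀, φ, hred₀, hφ, hredI₀, hredF₀, -, -, hχ0⟩ :=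
    exists_reductionDatum_of_frobeniusTrace_eq_zero (K := K) (⟨0, 0, 1, 0, -1⟩ : WeierstrassCurve ℚ) hΔ
      (p := 2) (M := 1) hl' ha0 hφ₀ hv₀ huniq hres h𝔓 (n := 1) (Nat.Prime.not_dvd_one hℓ) one_ne_zero
      hF hFfix
  -- injectivity of `red₀` on the `2`-torsion (`ℓ ∤ 2`)
  have hℓ2' : ¬ ℓ ∣ 2 := fun h ↦ hℓ2 ((Nat.prime_dvd_prime_iff_eq hℓ Nat.prime_two).mp h)
  have hinj₀ : ∀ x : geomPoints ((⟨0, 0, 1, 0, -1⟩ : WeierstrassCurve ℚ).baseChange K),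
      ((2 ^ 1 : ℕ) : ℤ) • x = 0 → red₀ x = 0 → x = 0 := by
    intro x hx h0
    rw [hred₀] at h0
    have e1 : ((2 ^ 1 : ℕ) : ℤ) • θ.symm (g₀⁻¹ • x) = 0 := by
      rw [← map_zsmul, ← KolyvaginCocycle.smul_zsmul_comm, hx, smul_zero, map_zero]
    have e2 : (2 : ℕ) • θ.symm (g₀⁻¹ • x) = 0 := by
      rw [← natCast_zsmul]
      exact_mod_cast e1
    have h1 := eq_zero_of_smul_eq_zero_of_geomReduction_eq_zero hΔ hℓ2' e2 h0
    have h2 : g₀⁻¹ • x = 0 := by rwa [AddEquiv.map_eq_zero_iff] at h1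
    have h3 : g₀ • g₀⁻¹ • x = g₀ • (0 : geomPoints ((⟨0, 0, 1, 0, -1⟩ : WeierstrassCurve ℚ).baseChange K)) :=
      congrArg (fun y ↦ g₀ • y) h2
    rwa [smul_inv_smul, smul_zero] at h3
  -- the frame: `red = red₀ ∘ κ`, the reduced CM maps `ρ̃_g` and the FLIP under Frobenius (k-ty1 #15)
  set red : geomPoints ((cubeSumCurve 9).baseChange K) →+
      (reductionModPrime (⟨0, 0, 1, 0, -1⟩ : WeierstrassCurve ℚ) ℓ).geomPoints :=
    red₀.comp κ.toAddMonoidHom with hred_def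
  have hred : ∀ x, red x = red₀ (κ x) := fun _ ↦ rfl
  have hc : ∀ g : absoluteGaloisGroup K,
      (((show AlgebraicClosure K ≃ₐ[K] AlgebraicClosure K from g) v / v) ^ 2) ^ 3 = 1 := by
    intro g
    rw [← pow_mul, show 2 * 3 = 3 * 2 from rfl, pow_mul, div_pow, hv3 g, div_self (pow_ne_zero 3 hv),
      one_pow]
  obtain ⟨ρt, hredρ, hφρ, hredI, hredF, hinj⟩ :=
    JZero.exists_reduced_mulX_frame hΔ rfl rfl rfl hℓ3 κ hκG hκ
      (c := fun g : absoluteGaloisGroup K ↦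
        ((show AlgebraicClosure K ≃ₐ[K] AlgebraicClosure K from g) v / v) ^ 2)
      hc ρ (fun g _ _ h ↦ hρ g h) g₀ hred₀ hφ₀ hφ (I := 𝔓.inertia (absoluteGaloisGroup K)) hredI₀
      hredF₀ hinj₀ hred
  -- `φ² = 1` on `Ẽ₀[2]`: Manin's relation `φ² = −ℓ` (`a_ℓ = 0`) and `ℓ` odd
  have hBn : ∀ b : (reductionModPrime (⟨0, 0, 1, 0, -1⟩ : WeierstrassCurve ℚ) ℓ).geomPoints,
      ((2 ^ 1 : ℕ) : ℤ) • b = 0 → φ (φ b) = b := by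
    intro b hb
    have hcard : Nat.card (ZMod ℓ) = ℓ := Nat.card_zmod ℓ
    have hφ' : ∀ x : AlgebraicClosure (ZMod ℓ), φ₀ • x = x ^ Nat.card (ZMod ℓ) := by
      rw [hcard]; exact hφ₀
    have h := (reductionModPrime (⟨0, 0, 1, 0, -1⟩ : WeierstrassCurve ℚ) ℓ).frobenius_frobenius_sub_trace_smul_add_card_smul hφ' b
    rw [hcard, ← frobeniusTrace_eq_sub_natCard_reductionModPrime _ ℓ, ha0, zero_smul,
      sub_zero] at h
    have hManin : φ (φ b) + (ℓ : ℤ) • b = 0 := by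
      rw [hφ, hφ]
      exact_mod_cast h
    have hb2 : (2 : ℤ) • b = 0 := by simpa using hb
    obtain ⟨k, hk⟩ := hℓ.odd_of_ne_two hℓ2
    have hℓb : (ℓ : ℤ) • b = b := by
      have hk' : (ℓ : ℤ) = k * 2 + 1 := by rw [hk]; push_cast; ring
      rw [hk', add_zsmul, one_zsmul, mul_zsmul, hb2, zsmul_zero, zero_add]
    rw [hℓb] at hManin
    have hbb : b + b = 0 := by rw [← two_zsmul]; exact hb2
    rw [eq_neg_of_add_eq_zero_left hManin]
    exact neg_eq_of_add_eq_zero_right hbb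
  -- the supersingular core with `a' = 0`
  have hχ : ∀ c : (reductionModPrime (⟨0, 0, 1, 0, -1⟩ : WeierstrassCurve ℚ) ℓ).geomPoints,
      φ (φ c) = c → (l' • φ c = 0 ↔ ∃ d, φ (φ d) = d ∧ (((2 : ℕ) : ℤ) ^ 1) • d = c) := fun c hc ↦ by
    rw [← hχ0 c hc, zero_smul, zero_sub, neg_eq_zero]
  exact ⟨g₀, red, φ, ρt, fun x ↦ by rw [hred, hred₀], hφ, hredρ, hφρ, hredI, hredF, hinj, hBn, hχ⟩

end Summit.BirchSwinnertonDyer.BirchSwinnertonDyer.Theorems.SylvesterTwoCMFlip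

end
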